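import Mathlib
import HarnessLib

/-!
# `Σ_{(d,q)=1} μ(d)/d² = (6/π²) ∏_{p ∣ q} (1 − p⁻²)⁻¹`

The density of primitive vectors of `ℤ²` in a residue class modulo `q` (see
`Literature/Algebra/EuclideanLattices/CoprimeLatticePointsEllipse.lean`, where the constant appears
as the series `Σ_{(d,q)=1} μ(d)/d²`) in closed form: removing from `1/ζ(2) = Σ μ(d)/d² = 6/π²` the
Euler factors at the primes dividing `q`. Proof: the Euler product (Mathlib's
`EulerProduct.eulerProduct_hasProd`) of the multiplicative function `d ↦ 1_{(d,q)=1} μ(d)/d²`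
has local factors `1 − p⁻²` at `p ∤ q` and `1` at `p ∣ q`; compare with the Euler product of
`μ(d)/d²`, whose value `6/π²` is Mathlib's `L(ζ,2) L(μ,2) = 1` and `ζ(2) = π²/6`.
Everything here is proved.
-/

noncomputable section

open Filter Topology Nat
open scoped ArithmeticFunction.Moebius

namespace Literature.NumberTheory.LFunctions

/-- `|1_{(d,q)=1} μ(d)/d²| ≤ 1/d²`. [folklore] -/
theorem norm_moebCop_le (q d : ℕ) :
    ‖(if d.Coprime q then (μ d : ℝ) / (d : ℝ) ^ 2 else 0)‖ ≤ 1 / (d : ℝ) ^ 2 := by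
  split_ifs
  · rw [Real.norm_eq_abs, abs_div, abs_of_nonneg (by positivity : (0 : ℝ) ≤ (d : ℝ) ^ 2)]
    refine div_le_div_of_nonneg_right ?_ (by positivity)
    exact_mod_cast ArithmeticFunction.abs_moebius_le_one
  · simp only [norm_zero]; positivity

/-- Summability of `1_{(d,q)=1} μ(d)/d²` (by comparison with `Σ 1/d²`). [folklore] -/
theorem summable_moebCop (q : ℕ) :
    Summable fun d : ℕ => if d.Coprime q then (μ d : ℝ) / (d : ℝ) ^ 2 else 0 :=
  Summable.of_norm_bounded (g := fun n : ℕ => 1 / (n : ℝ) ^ 2)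
    (Real.summable_one_div_nat_pow.mpr one_lt_two) (norm_moebCop_le q)

/-- **The Euler product** of `d ↦ 1_{(d,q)=1} μ(d)/d²`: local factor `1` at `p ∣ q` and
`1 − p⁻²` at `p ∤ q`. [folklore] -/
theorem hasProd_moebCop (q : ℕ) :
    HasProd (fun p : Nat.Primes => if (p : ℕ) ∣ q then (1 : ℝ) else 1 - ((p : ℝ) ^ 2)⁻¹)
      (∑' d : ℕ, if d.Coprime q then (μ d : ℝ) / (d : ℝ) ^ 2 else 0) := by
  set f : ℕ → ℝ := fun n => if n.Coprime q then (μ n : ℝ) / (n : ℝ) ^ 2 else 0 with hf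
  have hf1 : f 1 = 1 := by simp [hf]
  have hf0 : f 0 = 0 := by
    simp only [hf, ArithmeticFunction.map_zero, Int.cast_zero, zero_div, ite_self]
  have hmul : ∀ {m n : ℕ}, m.Coprime n → f (m * n) = f m * f n := by
    intro m n hmn
    simp only [hf]
    by_cases hm : m.Coprime q
    · by_cases hn : n.Coprime q
      · rw [if_pos (Nat.coprime_mul_iff_left.2 ⟨hm, hn⟩), if_pos hm, if_pos hn,
          ArithmeticFunction.isMultiplicative_moebius.map_mul_of_coprime hmn]
        push_cast
        ring
      · rw [if_neg (fun h => hn (Nat.coprime_mul_iff_left.1 h).2), if_neg hn, mul_zero]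
    · rw [if_neg (fun h => hm (Nat.coprime_mul_iff_left.1 h).1), if_neg hm, zero_mul]
  have hsum : Summable fun n => ‖f n‖ :=
    Summable.of_nonneg_of_le (fun _ => norm_nonneg _) (norm_moebCop_le q)
      (Real.summable_one_div_nat_pow.mpr one_lt_two)
  have h := EulerProduct.eulerProduct_hasProd hf1 hmul hsum hf0
  refine HasProd.congr_fun h fun p => ?_
  -- the local factor at `p`
  have hp : (p : ℕ).Prime := p.2
  have hsupp : ∀ e ∉ ({0, 1} : Finset ℕ), f ((p : ℕ) ^ e) = 0 := by
    intro e he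
    simp only [Finset.mem_insert, Finset.mem_singleton, not_or] at he
    simp only [hf, ArithmeticFunction.moebius_apply_prime_pow hp he.1, if_neg he.2, Int.cast_zero,
      zero_div, ite_self]
  rw [tsum_eq_sum hsupp, Finset.sum_pair zero_ne_one, pow_zero, pow_one, hf1]
  simp only [hf, ArithmeticFunction.moebius_apply_prime hp, hp.coprime_iff_not_dvd]
  by_cases hpq : (p : ℕ) ∣ q
  · simp [hpq]
  · rw [if_pos hpq, if_neg hpq]
    push_cast
    ring

/-- **`Σ μ(d)/d² = 6/π²`** (Mathlib: `L(ζ,2) L(μ,2) = 1`, `ζ(2) = π²/6`), in the form of the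
`q = 1` case of the series above. [folklore] -/
theorem tsum_moebCop_one :
    ∑' d : ℕ, (if d.Coprime 1 then (μ d : ℝ) / (d : ℝ) ^ 2 else 0) = 6 / Real.pi ^ 2 := by
  have hc : ∀ d : ℕ, (if d.Coprime 1 then (μ d : ℝ) / (d : ℝ) ^ 2 else 0) = (μ d : ℝ) / (d : ℝ) ^ 2 :=
    fun d => if_pos (Nat.coprime_one_right d)
  rw [tsum_congr hc]
  have hs : 1 < (2 : ℂ).re := by norm_num
  have hzeta : LSeries (fun n => (ArithmeticFunction.zeta n : ℂ)) 2 = (Real.pi : ℂ) ^ 2 / 6 := by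
    rw [ArithmeticFunction.LSeries_zeta_eq_riemannZeta hs, riemannZeta_two]
  have hmu : LSeries (fun n => (μ n : ℂ)) 2 = 6 / (Real.pi : ℂ) ^ 2 := by
    have h := ArithmeticFunction.LSeries_zeta_mul_Lseries_moebius hs
    rw [hzeta] at h
    have hpi : (Real.pi : ℂ) ^ 2 ≠ 0 := pow_ne_zero 2 (by exact_mod_cast Real.pi_ne_zero)
    field_simp at h
    field_simp
    linear_combination h
  have hterm : ∀ n : ℕ, (((μ n : ℝ) / (n : ℝ) ^ 2 : ℝ) : ℂ) = LSeries.term (fun n => (μ n : ℂ)) 2 n := by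
    intro n
    rcases eq_or_ne n 0 with rfl | hn
    · simp [LSeries.term_zero]
    · rw [LSeries.term_of_ne_zero hn, Complex.cpow_two]
      push_cast
      rfl
  have h : ((∑' n : ℕ, (μ n : ℝ) / (n : ℝ) ^ 2 : ℝ) : ℂ) = 6 / (Real.pi : ℂ) ^ 2 := by
    rw [Complex.ofReal_tsum, ← hmu, LSeries]
    exact tsum_congr hterm
  exact_mod_cast h

/-- **`Σ_{(d,q)=1} μ(d)/d² = (6/π²) ∏_{p ∣ q} (1 − p⁻²)⁻¹`** for `q ≥ 1`. [folklore] -/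
theorem tsum_moebius_div_sq_coprime {q : ℕ} (hq : 0 < q) :
    ∑' d : ℕ, (if d.Coprime q then (μ d : ℝ) / (d : ℝ) ^ 2 else 0) =
      6 / Real.pi ^ 2 * (∏ p ∈ q.primeFactors, (1 - ((p : ℝ) ^ 2)⁻¹))⁻¹ := by
  set ρq := ∑' d : ℕ, (if d.Coprime q then (μ d : ℝ) / (d : ℝ) ^ 2 else 0) with hρq
  set ρ1 := ∑' d : ℕ, (if d.Coprime 1 then (μ d : ℝ) / (d : ℝ) ^ 2 else 0) with hρ1
  have hq' := hasProd_moebCop q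
  have h1 := hasProd_moebCop 1
  -- the finite correction
  set T : Finset Nat.Primes := (q.primeFactors.attach).image
    fun x => (⟨x.1, Nat.prime_of_mem_primeFactors x.2⟩ : Nat.Primes) with hT
  have hmemT : ∀ p : Nat.Primes, p ∈ T ↔ (p : ℕ) ∈ q.primeFactors := by
    intro p
    rw [hT, Finset.mem_image]
    constructor
    · rintro ⟨x, -, rfl⟩; exact x.2
    · intro hp; exact ⟨⟨p, hp⟩, Finset.mem_attach _ _, Subtype.ext rfl⟩
  set h : Nat.Primes → ℝ := fun p => if (p : ℕ) ∣ q then 1 - ((p : ℝ) ^ 2)⁻¹ else 1 with hh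
  have hh1 : ∀ p ∉ T, h p = 1 := by
    intro p hp
    rw [hmemT] at hp
    show (if (p : ℕ) ∣ q then 1 - ((p : ℝ) ^ 2)⁻¹ else 1) = 1
    rw [if_neg]
    intro hdvd
    exact hp (Nat.mem_primeFactors.2 ⟨p.2, hdvd, hq.ne'⟩)
  have hprodT : ∏ p ∈ T, h p = ∏ p ∈ q.primeFactors, (1 - ((p : ℝ) ^ 2)⁻¹) := by
    rw [hT, Finset.prod_image]
    · rw [← Finset.prod_attach q.primeFactors]
      refine Finset.prod_congr rfl fun x _ => ?_
      show (if (x.1 : ℕ) ∣ q then 1 - ((x.1 : ℝ) ^ 2)⁻¹ else 1) = 1 - ((x.1 : ℝ) ^ 2)⁻¹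
      rw [if_pos (Nat.dvd_of_mem_primeFactors x.2)]
    · intro x _ y _ hxy
      exact Subtype.ext (by simpa using congr_arg Subtype.val hxy)
  have hH : HasProd h (∏ p ∈ q.primeFactors, (1 - ((p : ℝ) ^ 2)⁻¹)) := by
    rw [← hprodT]; exact hasProd_prod_of_ne_finset_one hh1
  -- `g₁ = g_q * h`
  have hmul := hq'.mul hH
  have heq : (fun p : Nat.Primes => (if (p : ℕ) ∣ q then (1 : ℝ) else 1 - ((p : ℝ) ^ 2)⁻¹) * h p) =
      fun p : Nat.Primes => if (p : ℕ) ∣ 1 then (1 : ℝ) else 1 - ((p : ℝ) ^ 2)⁻¹ := by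
    funext p
    have hp1 : ¬(p : ℕ) ∣ 1 := fun hd => p.2.ne_one (Nat.dvd_one.1 hd)
    rw [if_neg hp1, hh]
    by_cases hpq : (p : ℕ) ∣ q <;> simp [hpq]
  rw [heq] at hmul
  have huniq : ρ1 = ρq * ∏ p ∈ q.primeFactors, (1 - ((p : ℝ) ^ 2)⁻¹) := h1.unique hmul
  have hpos : 0 < ∏ p ∈ q.primeFactors, (1 - ((p : ℝ) ^ 2)⁻¹) := by
    refine Finset.prod_pos fun p hp => ?_
    have hp2 : (2 : ℝ) ≤ p := by exact_mod_cast (Nat.prime_of_mem_primeFactors hp).two_le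
    have : ((p : ℝ) ^ 2)⁻¹ ≤ 1 / 4 := by
      rw [inv_eq_one_div]
      exact div_le_div_of_nonneg_left zero_le_one (by norm_num) (by nlinarith)
    linarith
  have hρ1v : ρ1 = 6 / Real.pi ^ 2 := tsum_moebCop_one
  rw [hρ1v] at huniq
  rw [eq_mul_inv_iff_mul_eq₀ hpos.ne', ← huniq]

end Literature.NumberTheory.LFunctions
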